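import Summits.BirchSwinnertonDyer.BirchSwinnertonDyer.Theorems.PrintCf2SplitBadTwoCyclicInfResFinite
import Summits.BirchSwinnertonDyer.BirchSwinnertonDyer.Theorems.PrintCf2SplitBadTwoLineUnrSelmerTransport
import HarnessLib

/-!
# Crux `PrintCf2.SplitBadTwoRankOneOfFacts` (stmt-BirchSwinnertonDyer-20368), S3a-quad brick (e2): INFLATION–RESTRICTION ALONG A
# FINITE CYCLIC QUOTIENT, IIIb — WITH SELMER CONDITIONS: `res : S^{S₀}_M(K̄^H) → S^{S₀}_M(K̄^{H′})^{γ}` for the Greenberg–Vatsal /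
# Castella datum `bdpData M p 𝔭` has finitely many cosets in its target and (under a fixed-point-free generator) trivial kernel

Cell `bsd-print-cf2`, width seat `bsd-line-cf2-p1-w5` g6 («width 5»), `--supports stmt-BirchSwinnertonDyer-20368 --as helper`, Theses-free.
HONEST FRAMING: nothing here closes the crux or a registered stub; no summit statement is proved by this seat; BSD is not proved by any of this.
No definition, no named fact, no `sorry`. Sequel of files I–II (`…PrintCf2SplitBadTwoCyclicInfRes`, `…CyclicInfResFinite`); sibling IIIa `…CyclicInfResTransfer`.

Setting: `K` a number field, `H′ ≤ H ≤ Γ_K` normal subgroups with `H′` relatively open in `H`, `γ ∈ H` generating the finite cyclic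
quotient `H/H′` of order `t` (`γᵗ ∈ H′`, `γᵈ ∈ H′ ⟹ t ∣ d`, `H = ⋃_{k<t} γᵏ H′`), `M` a discrete `Γ_K`-module, `p`, a finite place `𝔭`
(Castella's datum `bdpData M p 𝔭`: unramified condition above `𝔭`, relaxed above the other primes over `p`), `S₀` a set of places.
Write `Sel(H) = datumSelmer H M p (bdpData M p 𝔭) S₀`.

* (§1, the back-transfer `hback` of the Selmer conditions along `res` under injectivity of the local restrictions, is file IIIa
  `…CyclicInfResTransfer`: `resOfLe_mem_datumSelmer_bdpData_iff_of_injective`;)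
* §2 **`exists_finset_datumSelmer_sub_mem_range_resOfLe`** — given the finite transversal `𝒜` of `Ĥ⁰(⟨γ⟩, M^{H′})` (file II) and the
  back-transfer of §1, every `γ`-invariant class of `Sel(H′)` is `s₀ + res y` with `s₀` in a finite set `F ⊆ Sel(H′)^γ`, `#F ≤ #𝒜`, and
  `y ∈ Sel(H)` — and the QUOTIENT FORMS **`finite_quotient_range_of_hom_eq_resOfLe`** (ANY `S′` with the elements of `Sel(H′) ∩ {conj_γ = 1}`
  and any `g : Sel(H) → S′` agreeing with `res` on classes — the consumer's own model) and `finite_quotient_range_resOfLe_datumSelmer`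
  (`S′ := Sel(H′) ⊓ ker(conj_γ − 1)`, `g :=` the (co)restricted `res`): `Finite (S′ ⧸ g.range)` with `Nat.card ≤ #𝒜` — the literal `[Finite (S ⧸ g.range)]`
  input of cf2c-w6 g2's `DualTranspose.finite_ker_transpose_of_finite_quotient_range` (p690891);
* §3 `forall_conjH1_eq_iff_conjH1_eq` — `γ`-invariance is `H`-invariance (`conj_n = 1` for `n ∈ H′`); `injective_codRestrict_resOfLe` — the
  kernel side (`Function.Injective g` from file II, hence `Finite g.ker`).

presearch: Greenberg–Vatsal 2000 §2 p. 17 (transfer of local conditions along unramified restriction), Greenberg LNM 1716 §3 Lemma 3.3;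
NSW I §6 Prop. 1.6.7 — held/cited; nothing new filed. beyond-print theorem: no.

References: [GreenbergVatsal2000] §2 pp. 16–17, 20; [GreenbergLNM1716] §3; [NeukirchSchmidtWingberg2008] I.§6 Prop. 1.6.7;
[Castella2018] Def. 2.2.
-/

noncomputable section

open scoped Classical

set_option linter.dupNamespace false -- D-0017: `…BirchSwinnertonDyer.BirchSwinnertonDyer…` repeats a namespace by design
set_option autoImplicit false

open NumberField IsDedekindDomain Field
open Literature.NumberTheory.EllipticCurves Literature.NumberTheory.EllipticCurves.GreenbergSelmer
open Literature.NumberTheory.EllipticCurves.GreenbergVatsal2000 Literature.NumberTheory.EllipticCurves.Castella2018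
open Literature.NumberTheory.GaloisRepresentations
open Summit.BirchSwinnertonDyer.BirchSwinnertonDyer.Theorems.IwasawaTwoVariable
open Summit.BirchSwinnertonDyer.BirchSwinnertonDyer.Theorems.PrintCf2.CyclicInfRes

universe u

namespace Summit.BirchSwinnertonDyer.BirchSwinnertonDyer.Theorems.PrintCf2.CyclicInfResSelmer

variable {K : Type u} [Field K] [NumberField K] {H' H : Subgroup (absoluteGaloisGroup K)}
  {M : Type u} [AddCommGroup M] [DistribMulAction (absoluteGaloisGroup K) M] [TopologicalSpace M] [DiscreteTopology M]

variable [H'.Normal] [H.Normal] (p : ℕ) (S₀ : Set (HeightOneSpectrum (𝓞 K)))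

/-! ## §2. The cokernel: finitely many cosets of `res Sel(H)` in the `γ`-invariants of `Sel(H′)` -/

/-- **Every `γ`-invariant class of `Sel(H′)` is `s₀ + res y` with `y ∈ Sel(H)` and `s₀` in a finite set `F ⊆ Sel(H′)^γ`, `#F ≤ #𝒜`.**
Here `𝒜 ⊆ M` is a finite transversal of `Ĥ⁰(⟨γ⟩, M^{H′})` (every `H′`-fixed, `γ`-fixed `a` is `a₀ + Σ_{i<t} γⁱ·b`, `a₀ ∈ 𝒜`, `b`
`H′`-fixed) and `hback` is the back-transfer of the Selmer conditions along `res` (§1, e.g. `resOfLe_mem_datumSelmer_bdpData_iff_of_injective`).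
File II's `exists_finset_sub_mem_range_resOfLe` on the set `P = Sel(H′) ∩ {conj_γ = 1}`; the lift of `s − s₀ ∈ Sel(H′)` lands in `Sel(H)` by
`hback`. [cite: NeukirchSchmidtWingberg2008, I.§6 Prop. 1.6.7] [cite: GreenbergVatsal2000, §2 pp. 16–17, 20] -/
theorem exists_finset_datumSelmer_sub_mem_range_resOfLe (hle : H' ≤ H) {γ : absoluteGaloisGroup K} (hγ : γ ∈ H) {t : ℕ}
    (ht : 0 < t) (hγt : γ ^ t ∈ H') (hdvd : ∀ d : ℕ, γ ^ d ∈ H' → t ∣ d) (hcover : ∀ g ∈ H, ∃ k < t, ∃ n ∈ H', g = γ ^ k * n)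
    (hopen : IsOpen ((H'.subgroupOf H : Subgroup H) : Set H)) (L : Data K M p)
    (𝒜 : Finset M)
    (h𝒜 : ∀ a : M, (∀ n ∈ H', n • a = a) → γ • a = a →
      ∃ a₀ b : M, a₀ ∈ 𝒜 ∧ (∀ n ∈ H', n • b = b) ∧ a = a₀ + ∑ i ∈ Finset.range t, γ ^ i • b)
    (hback : ∀ c : subgroupH1 H M, resOfLe M hle c ∈ datumSelmer H' M p L S₀ → c ∈ datumSelmer H M p L S₀) :
    ∃ F : Finset (subgroupH1 H' M),
      (↑F ⊆ {s | s ∈ datumSelmer H' M p L S₀ ∧ conjH1 H' M γ s = s}) ∧ F.card ≤ 𝒜.card ∧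
      ∀ s ∈ datumSelmer H' M p L S₀, conjH1 H' M γ s = s →
        ∃ s₀ ∈ F, ∃ y ∈ datumSelmer H M p L S₀, resOfLe M hle y = s - s₀ := by
  obtain ⟨F, hFP, hcard, hF⟩ := exists_finset_sub_mem_range_resOfLe (M := M) hle hγ ht hγt hdvd hcover hopen 𝒜 h𝒜
    {s | s ∈ datumSelmer H' M p L S₀ ∧ conjH1 H' M γ s = s} (fun s hs ↦ hs.2)
  refine ⟨F, hFP, hcard, fun s hs hγs ↦ ?_⟩
  obtain ⟨s₀, hs₀, y, hy⟩ := hF s ⟨hs, hγs⟩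
  refine ⟨s₀, hs₀, y, hback y ?_, hy⟩
  rw [hy]
  exact (datumSelmer H' M p L S₀).sub_mem hs (hFP hs₀).1

/-- `res` maps `Sel(H)` into the `γ`-invariants of `Sel(H′)` (`γ ∈ H`): `resOfLe_mem_datumSelmer` and `conjH1_resOfLe_eq_of_mem`.
[cite: GreenbergVatsal2000, §2 pp. 17, 20] -/
theorem resOfLe_mem_datumSelmer_inf_ker (hle : H' ≤ H) {γ : absoluteGaloisGroup K} (hγ : γ ∈ H) (L : Data K M p)
    (c : datumSelmer H M p L S₀) :
    resOfLe M hle (c : subgroupH1 H M) ∈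
      datumSelmer H' M p L S₀ ⊓ (conjH1 H' M γ - AddMonoidHom.id (subgroupH1 H' M)).ker := by
  refine AddSubgroup.mem_inf.mpr ⟨resOfLe_mem_datumSelmer p L S₀ hle c.2, ?_⟩
  rw [AddMonoidHom.mem_ker, AddMonoidHom.sub_apply, AddMonoidHom.id_apply, sub_eq_zero]
  exact conjH1_resOfLe_eq_of_mem hle hγ _

/-- **QUOTIENT FORM, for ANY model of the target — `Finite (S′ ⧸ g.range)` with `#(S′ ⧸ g.range) ≤ #𝒜`** whenever `S′ ≤ H¹(H′, M)` has the
same elements as `Sel(H′) ∩ {conj_γ = 1}` and `g : Sel(H) → S′` agrees with `res` on underlying classes: the literal shape of the hypothesis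
`[Finite (S ⧸ g.range)]` of cf2c-w6 g2's `DualTranspose.finite_ker_transpose_of_finite_quotient_range` (the transpose `sX` then has FINITE KERNEL),
with the consumer's own `S′` and `g`. Inputs as in `exists_finset_datumSelmer_sub_mem_range_resOfLe`.
[cite: NeukirchSchmidtWingberg2008, I.§6 Prop. 1.6.7] [cite: GreenbergLNM1716, §1 (after Conj. 1.3)] -/
theorem finite_quotient_range_of_hom_eq_resOfLe (hle : H' ≤ H) {γ : absoluteGaloisGroup K} (hγ : γ ∈ H) {t : ℕ}
    (ht : 0 < t) (hγt : γ ^ t ∈ H') (hdvd : ∀ d : ℕ, γ ^ d ∈ H' → t ∣ d) (hcover : ∀ g ∈ H, ∃ k < t, ∃ n ∈ H', g = γ ^ k * n)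
    (hopen : IsOpen ((H'.subgroupOf H : Subgroup H) : Set H)) (L : Data K M p)
    (𝒜 : Finset M)
    (h𝒜 : ∀ a : M, (∀ n ∈ H', n • a = a) → γ • a = a →
      ∃ a₀ b : M, a₀ ∈ 𝒜 ∧ (∀ n ∈ H', n • b = b) ∧ a = a₀ + ∑ i ∈ Finset.range t, γ ^ i • b)
    (hback : ∀ c : subgroupH1 H M, resOfLe M hle c ∈ datumSelmer H' M p L S₀ → c ∈ datumSelmer H M p L S₀)
    (S' : AddSubgroup (subgroupH1 H' M)) (hS' : ∀ s : subgroupH1 H' M, s ∈ S' ↔ s ∈ datumSelmer H' M p L S₀ ∧ conjH1 H' M γ s = s)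
    (g : ↥(datumSelmer H M p L S₀) →+ ↥S') (hg : ∀ c : ↥(datumSelmer H M p L S₀), ((g c : ↥S') : subgroupH1 H' M) = resOfLe M hle c) :
    Finite (↥S' ⧸ g.range) ∧ Nat.card (↥S' ⧸ g.range) ≤ 𝒜.card := by
  classical
  obtain ⟨F, hFP, hcard, hF⟩ :=
    exists_finset_datumSelmer_sub_mem_range_resOfLe p S₀ hle hγ ht hγt hdvd hcover hopen L 𝒜 h𝒜 hback
  -- the coset map restricted to `F` is onto
  let q : F → ↥S' ⧸ g.range := fun x ↦ QuotientAddGroup.mk ⟨x.1, (hS' x.1).mpr (hFP x.2)⟩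
  have hq : Function.Surjective q := by
    intro z
    induction z using QuotientAddGroup.induction_on with
    | H s =>
    obtain ⟨hs, hγs⟩ := (hS' s).mp s.2
    obtain ⟨s₀, hs₀, y, hy, hres⟩ := hF s hs hγs
    refine ⟨⟨s₀, hs₀⟩, ?_⟩
    refine (QuotientAddGroup.eq_iff_sub_mem).mpr ?_
    -- `s₀ - s = g (-y)`
    refine ⟨-⟨y, hy⟩, Subtype.ext ?_⟩
    rw [map_neg, AddSubgroup.coe_neg, hg, AddSubgroup.coe_sub]
    change -(resOfLe M hle y) = s₀ - (s : subgroupH1 H' M)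
    rw [hres, neg_sub]
  haveI : Finite (↥S' ⧸ g.range) := Finite.of_surjective q hq
  refine ⟨this, ?_⟩
  calc Nat.card (↥S' ⧸ g.range) ≤ Nat.card F := Nat.card_le_card_of_surjective q hq
    _ = F.card := by rw [Nat.card_eq_fintype_card, Fintype.card_coe]
    _ ≤ 𝒜.card := hcard

/-- **QUOTIENT FORM in the tree's own model — `S′ := Sel(H′) ⊓ ker(conj_γ − 1)`, `g :=` the (co)restricted `res`**: `Finite (S′ ⧸ g.range)` with
`Nat.card ≤ #𝒜` (`finite_quotient_range_of_hom_eq_resOfLe` with `hS'`, `hg` by unfolding).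
[cite: NeukirchSchmidtWingberg2008, I.§6 Prop. 1.6.7] [cite: GreenbergLNM1716, §1 (after Conj. 1.3)] -/
theorem finite_quotient_range_resOfLe_datumSelmer (hle : H' ≤ H) {γ : absoluteGaloisGroup K} (hγ : γ ∈ H) {t : ℕ}
    (ht : 0 < t) (hγt : γ ^ t ∈ H') (hdvd : ∀ d : ℕ, γ ^ d ∈ H' → t ∣ d) (hcover : ∀ g ∈ H, ∃ k < t, ∃ n ∈ H', g = γ ^ k * n)
    (hopen : IsOpen ((H'.subgroupOf H : Subgroup H) : Set H)) (L : Data K M p)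
    (𝒜 : Finset M)
    (h𝒜 : ∀ a : M, (∀ n ∈ H', n • a = a) → γ • a = a →
      ∃ a₀ b : M, a₀ ∈ 𝒜 ∧ (∀ n ∈ H', n • b = b) ∧ a = a₀ + ∑ i ∈ Finset.range t, γ ^ i • b)
    (hback : ∀ c : subgroupH1 H M, resOfLe M hle c ∈ datumSelmer H' M p L S₀ → c ∈ datumSelmer H M p L S₀) :
    Finite (↥(datumSelmer H' M p L S₀ ⊓ (conjH1 H' M γ - AddMonoidHom.id (subgroupH1 H' M)).ker) ⧸
        (((resOfLe M hle).comp (datumSelmer H M p L S₀).subtype).codRestrict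
          (datumSelmer H' M p L S₀ ⊓ (conjH1 H' M γ - AddMonoidHom.id (subgroupH1 H' M)).ker)
          (fun c ↦ resOfLe_mem_datumSelmer_inf_ker p S₀ hle hγ L c)).range) ∧
      Nat.card (↥(datumSelmer H' M p L S₀ ⊓ (conjH1 H' M γ - AddMonoidHom.id (subgroupH1 H' M)).ker) ⧸
        (((resOfLe M hle).comp (datumSelmer H M p L S₀).subtype).codRestrict
          (datumSelmer H' M p L S₀ ⊓ (conjH1 H' M γ - AddMonoidHom.id (subgroupH1 H' M)).ker)
          (fun c ↦ resOfLe_mem_datumSelmer_inf_ker p S₀ hle hγ L c)).range) ≤ 𝒜.card :=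
  finite_quotient_range_of_hom_eq_resOfLe p S₀ hle hγ ht hγt hdvd hcover hopen L 𝒜 h𝒜 hback _
    (fun s ↦ by
      rw [AddSubgroup.mem_inf, AddMonoidHom.mem_ker, AddMonoidHom.sub_apply, AddMonoidHom.id_apply, sub_eq_zero])
    _ (fun _ ↦ rfl)

/-! ## §3. Invariance under `H` versus under `γ`; the kernel side -/

omit [NumberField K] [H.Normal] in
/-- **`γ`-invariance is `H`-invariance** when `H = ⋃_k γᵏ H′`: `conj_n` is the identity on `H¹(H′, M)` for `n ∈ H′` (`conjH1_of_mem_holds`),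
and `conj` is multiplicative (`conjH1_mul_holds`). [cite: SerreLocalFields1979, VII.§5 Prop. 3] -/
theorem forall_conjH1_eq_iff_conjH1_eq {γ : absoluteGaloisGroup K} (hγ : γ ∈ H)
    (hcover : ∀ g ∈ H, ∃ k : ℕ, ∃ n ∈ H', g = γ ^ k * n) (s : subgroupH1 H' M) :
    (∀ g ∈ H, conjH1 H' M g s = s) ↔ conjH1 H' M γ s = s := by
  refine ⟨fun h ↦ h γ hγ, fun h g hg ↦ ?_⟩
  obtain ⟨k, n, hn, rfl⟩ := hcover g hg
  have hpow : ∀ k : ℕ, conjH1 H' M (γ ^ k) s = s := by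
    intro k
    induction k with
    | zero => rw [pow_zero, conjH1_one_holds H' M, AddMonoidHom.id_apply]
    | succ k ih => rw [pow_succ, conjH1_mul_holds H' M, AddMonoidHom.comp_apply, h, ih]
  rw [conjH1_mul_holds H' M, AddMonoidHom.comp_apply, conjH1_of_mem_holds H' M hn, AddMonoidHom.id_apply, hpow]

/-- **The kernel side: `g : Sel(H) → S′` is injective** (hence `Finite g.ker`) as soon as `res : H¹(H, M) → H¹(H′, M)` is — file II's
`resOfLe_injective_of_forall_exists_eq_smul_sub` (`(γ − 1)M^{H′} = M^{H′}`) or `resOfLe_injective_of_ge`. [cite: GreenbergLNM1716, §3 Lemma 3.1] -/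
theorem injective_codRestrict_resOfLe (hle : H' ≤ H) {γ : absoluteGaloisGroup K} (hγ : γ ∈ H) (L : Data K M p)
    (hinj : Function.Injective (resOfLe M hle)) :
    Function.Injective (((resOfLe M hle).comp (datumSelmer H M p L S₀).subtype).codRestrict
      (datumSelmer H' M p L S₀ ⊓ (conjH1 H' M γ - AddMonoidHom.id (subgroupH1 H' M)).ker)
      (fun c ↦ resOfLe_mem_datumSelmer_inf_ker p S₀ hle hγ L c)) := by
  intro c c' h
  have h' := congrArg Subtype.val h
  exact Subtype.ext (hinj h')

end Summit.BirchSwinnertonDyer.BirchSwinnertonDyer.Theorems.PrintCf2.CyclicInfResSelmer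

end
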